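/-
Copyright: public-audit package `pub-balaban` (b2b-balaban), seat pv28-g6. Released under Apache 2.0 like Mathlib.
-/
import Literature.MathematicalPhysics.QuantumFieldTheory.Balaban1983to89.T4CoReadAxial
import Literature.MathematicalPhysics.QuantumFieldTheory.Balaban1983to89.T4FlatExteriorInvariance

/-!
# T4 / O3b–H2, row G7: THE RESIDUAL AXIS SYMMETRY (A1) FOR THE MODEL CONDITIONAL LAW AT AN AXIAL EXTERIOR, ITS
# Ad-COVARIANCE IN THE EXTERIOR (WEYL-ODDNESS OF THE SURVIVING SCALAR), AND THE LIPSCHITZ HALF OF O-G7 AS AN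
# ANALYTICITY RADIUS AND A SUP BOUND (pub-balaban, row T4-O3.E-iii-b-G7°, kernel sub-row T4-O3.E-iii-b-AX4*,
# seat pv28-g6)

HONEST FRAMING (cell `pub-balaban`, referee / M–L capacity; T4-DAG v8 §5 row T4-O3.E-iii-b-G7° «residual
invariance of the actual conditional law at a non-flat exterior + a K-uniform Lipschitz modulus for the one
surviving axial scalar»).  This module proves NO statement of Bałaban's papers (B12/B13/B15/B16 of the cell's
bibliography) and asserts nothing about Bałaban's densities; B12/B13 are not even locations here — locating is the
record's job (`t4/T4-EST-O3Eiiib-G7.md`).  Every declaration is [folklore] over Mathlib and the cell's own typed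
objects; no declaration carries a `[cite:]` tag.  What the module does: (i) it DISCHARGES, BY NAME, the
residual-symmetry hypothesis (A1) of `T4CoReadAxial` (pv28-g5/g6) for the cell's MODEL of the conditional law —
pv04-g5's `T4DressingDefect.condLaw s old V` («E_t[· | V_out]»: the density `old` against product Haar on the fibre
of bond variables over `s`, exterior `V`) — at every AXIAL exterior; (ii) it records the exact COVARIANCE of that
model law in the exterior (no fixedness hypothesis) and its consequence, the WEYL-ODDNESS of the one surviving
scalar; (iii) it reduces the quantitative half of O-G7 (a Lipschitz modulus) to two inputs of the printed SPECIES (an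
analyticity radius and a sup bound) by Schwarz's lemma.  Row O3.E-iii-b's ESTIMATE stays OPEN.  Value = by-name
discharge of a typed hypothesis for the model law + exact structural identities + a precise relocation of the
remaining gap, NOT summit progress (rung (B)+1 ≠ infinite volume / mass gap / Clay).

THE OBLIGATION (record `t4/T4-EST-O3Eiiib.md` v2.4 §5 O-G7; GAPS G-pv28g5-1).  After pv28-g5/g6 the co-read
second-order term at a NON-FLAT exterior is ONE complex scalar per pair, `a(u)(p) = (E[[B_b, B_b′] | u])₀₀` in
axis-adapted coordinates (`T4CoReadAxial.pairMeanField_eq_axial`), PROVIDED the conditional law at the exterior `u`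
has the residual axis symmetry (A1) (`T4CoReadAxial.AxisConjInvariant`); and the estimate wants
`‖a(u)(p)‖ ≤ lip₂·dev u` (`T4CoReadMoment.pairMean_norm_le_of_lipschitz`, hypothesis `hL`).  Two things were left
un-typed: (A1) ITSELF for the law (v2.4: «= row O3.E-i′ (α) species»), and the Lipschitz modulus.

WHAT IS PROVED (kernel, 0 sorry, axioms ⊆ {propext, Classical.choice, Quot.sound}).
§1 (G7-1) AXIS ALGEBRA.  Axis elements of SU(2) commute (`commute_of_isAxis` — the axis `{diag(w, w̄)}` is the
  maximal torus), so an axis element is fixed under conjugation by any axis element (`conj_eq_of_isAxis`);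
  conversely an element fixed under conjugation by `diag(i, −i)` is on the axis (`isAxis_of_phaseU_conj_eq`).
§2 (G7-2) THE DISCHARGE.  HYPOTHESIS SHAPE `AxialExterior s V := ∀ b ∉ s, IsAxis (V b)` — the exterior bond
  variables lie on the axis (a uni-directional background in axis-adapted colour coordinates; flat ⇒ axial,
  `axialExterior_of_flat`).  An axial exterior is `ConjFixedOff s h V` for EVERY axis element `h`
  (`AxialExterior.conjFixedOff`), and the axial exteriors are EXACTLY the exteriors fixed off `s` by all axis
  conjugations (`axialExterior_iff_conjFixedOff`) — the natural exterior class of (A1), not a convenient sub-case.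
  Hence, by pv04-g6's `T4FlatExteriorInvariance.condLaw_map_conjFun`: a conjugation-invariant density
  (`ConjInvariant old`, whose printed source — gauge invariance of the effective densities at constant gauge
  transformations — is pv04-g6's located reading, `conjInvariant_of_gaugeInvariant`) and an axial exterior give
  `AxisConjInvariant (condLaw s old V) conjAll` (`axisConjInvariant_condLaw`): (A1) BY NAME for the model law; also
  the single-element form (A1′) (`phaseConjInvariant_condLaw`) and the fibre-law form
  (`fibreLaw_map_conjAll_of_isAxis`).  At a flat exterior this is pv04-g6's full invariance restricted to the axis;
  at an axial non-flat exterior it is new kernel content (full invariance fails there — `T4CoReadAxial.orbitLaw` is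
  the two-point model of exactly this situation, `orbitLaw_axisConjInvariant` / `orbitLaw_not_flat`).
§3 (G7-3) CONSEQUENCES BY NAME for the model law at an axial exterior: the conditional mean of a commutator of
  equivariant fibre inserts is axial (`integral_mcomm_condLaw_eq_axial`); the pair mean field is axial pair by pair
  (`pairMeanField_condLaw_eq_axial`); transverse contractions vanish
  (`integral_clm_mcomm_condLaw_eq_zero_of_transverse`); a single traceless equivariant insert has axial mean
  (`integral_condLaw_eq_axial`).  NON-VACUITY: the coordinate inserts `y ↦ y_b` are `conjAll`-equivariant
  (`coordInsert_conjEquivariant`, by `rfl`: `h⁻¹ = h⋆` in SU(2)), and equivariance is closed under entrywise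
  adjoint, sums, complex multiples and the anti-Hermitian part (`conjEquivariant_star/_add/_smul/_antiHerm`;
  products / differences / commutators are pv28-g4's `T4CoReadMoment.conjEquivariant_mprod/_sub/_mcomm`), so the
  `𝔲(2)`-projections `(y_b − y_b⋆)/2` of the bond variables and their polynomial expressions are admissible
  inserts (`pairMeanField_condLaw_coord_eq_axial`).
§4 (G7-4) THE LIPSCHITZ HALF IS SCHWARZ'S LEMMA.  For `a : 𝒰 → E` (`𝒰`, `E` complex normed spaces: one complex
  deformation parameter, or a complex Banach space of complexified exterior fields), complex-differentiable on
  the ball of radius `R` about `u₀` with oscillation `≤ M` there: `‖a u − a u₀‖ ≤ (M/R)·‖u − u₀‖`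
  (`norm_sub_le_div_mul_of_differentiableOn`; Mathlib's `Complex.dist_le_div_mul_dist_of_mapsTo_ball`); with
  `a u₀ = 0`: `‖a u‖ ≤ (M/R)·‖u − u₀‖` (`norm_le_div_mul_of_differentiableOn`); and the hypothesis `hL` of
  `pairMean_norm_le_of_lipschitz` is DISCHARGED with `lip = M/R`, `dev u = ‖u − u₀‖`
  (`pairMean_lipschitz_of_differentiableOn`, `pairMean_norm_le_of_differentiableOn`); the constant is attained
  (`schwarz_const_sharp`).  So G-pv28g5-1's «K-uniform Lipschitz modulus» IS a K-uniform pair `(R, M)`: an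
  analyticity radius of the conditional pair mean in the (complexified) background and a uniform bound on that
  domain — inputs of the SPECIES of the printed analyticity-domain estimates, HYPOTHESES here (see (N3)).
§5 (G7-5/6) COVARIANCE IN THE EXTERIOR AND WEYL-ODDNESS.  With NO fixedness hypothesis the model laws are
  covariant: `(conj_g)_* (fibreLaw s old V) = fibreLaw s old (g·V·g⁻¹)` and the same for `condLaw`
  (`fibreLaw_map_conjFun_eq`, `condLaw_map_conjFun_eq`, `integral_condLaw_conjFun_eq`; transport lemma
  `map_withDensity_comp_eq`, insertion identity `updateFinset_conjFun_conjFun`; the MEASURE-level twin of pv06-g8's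
  FORM-level `T4NestedCovarianceFibre.covariant_condForm`, needing no `Measurable old` / `0 ≤ old`; pv04-g6's
  `condLaw_map_conjFun` is the fixed-exterior case via `condLaw_eq_of_eq_off`).  For `G = SU(2)` THE CONDITIONAL
  MEAN OF AN EQUIVARIANT INSERT IS Ad-EQUIVARIANT IN THE EXTERIOR: `E[F | h·V·h⁻¹] = h·E[F | V]·h⋆` for every `h`
  and EVERY exterior `V` (`integral_condLaw_conj_exterior`; `conjOpEquiv`, `integral_conjOp_comm` — no
  integrability binder: conjugation is an automorphism).  At the Weyl element `w₀ = [[0,1],[−1,0]]` (`weylU`: it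
  inverts the axis, `weylU_conj_axisU`, and exchanges the diagonal entries) this is (G7-6) WEYL-ODDNESS of the
  surviving scalar: `a(w₀Vw₀⁻¹) = −a(V)` for every exterior and every traceless equivariant insert
  (`integral_condLaw_weylU_apply_00`, `pairMean_condLaw_weylU_odd`); for an axis-valued field
  `V = (b ↦ diag(w_b, w̄_b))` (`axisField`) the Weyl reflection is complex conjugation of the background
  (`conjFun_weylU_axisField`), so `a(w̄) = −a(w)` (`pairMean_condLaw_axisField_odd`); and along every
  one-parameter axial deformation `t ↦ (b ↦ diag(e^{itθ_b}, e^{−itθ_b}))` of the flat exterior (`axisPath`,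
  `axisPath_zero`, `axisPath_neg`) the scalar is an ODD function of `t` (`pairMean_condLaw_axisPath_odd`): zero at
  `t = 0` — (K9), now from oddness alone (`pairMean_condLaw_axisPath_zero`) — together with all its even Taylor
  coefficients, the first-order one being bounded by `M/R` under (G7-4).

WHAT IS NOT PROVED / NOT PRINTED (record `t4/T4-EST-O3Eiiib-G7.md` v1).  (N1) That Bałaban's conditional
densities ARE of the shape `condLaw s old V` with `ConjInvariant old` is row O3.E-i′ (α)'s located READING
(pv04-g5/g6, pv06-g7/g8 records), used here by declaration name only; this module adds nothing to it.  (N2)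
Bałaban's backgrounds are not axis-valued in general: (G7-2) covers the flat exterior and its axial deformations;
at a GENERIC exterior no residual symmetry survives, the full `𝒟`-contraction of O3.E-iii-b is needed (record
v2.4 §5), and (G7-5) is what remains true there (covariance), which by itself bounds nothing.  (N3) The
analyticity of `u ↦ a(u)(p)` in a complexified background with a K-UNIFORM radius `R` and bound `M` is NOT
asserted: it is of the SPECIES of the printed analyticity statements for the effective densities in complexified
fields, whose applicability to the conditional pair mean is a LOCATING task of the record, not done in Lean; in
the model, `condLaw` is defined at SU(2)-valued exteriors only, so the complex parameter of §4 is abstract.  (N4)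
No summation over pairs, no coefficient bound, no `K`-count: rows O3.E-iii-b (A6)–(A8) / O3.E-ii.

Depends on `T4CoReadAxial` (pv28-g5/g6: `IsAxis`, `AxisConjInvariant`, `PhaseConjInvariant`, `integral_eq_axial`,
`integral_mcomm_eq_axial`, `pairMeanField_eq_axial`, `axisU`, `axisMat`, `IsAxis.exists_eq_axisU`,
`apply_offDiag_eq_zero_of_phaseU_invariant`), `T4FlatExteriorInvariance` (pv04-g6: `ConjInvariant`,
`ConjFixedOff`, `conjFun`, `conjEquiv`, `pi_haar_map_conjFun`, `fibreLaw_map_conjFun`, `condLaw_map_conjFun`,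
`measurable_conjFun`), `T4DressingDefect` (pv04-g5: `fibreLaw`, `condLaw`), `T4AdInvariant` (pv18: `conjOp`,
`conjAll`, `ConjEquivariant`, `phaseU`, `swapU`, `trace_integral_eq_zero`), `T4CoReadMoment` (pv28-g4: `mcomm`,
`pairMeanField`, `pairMean_norm_le_of_lipschitz`, `conjEquivariant_mcomm/_sub`, `trace_mcomm`) and Mathlib
(`Complex.dist_le_div_mul_dist_of_mapsTo_ball`, `ContinuousLinearEquiv.integral_comp_comm`,
`Function.updateFinset`, `Circle.exp`).  All new declarations [folklore]; no `[cite:]`.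

v1.0.1 (DOCFIX after XREAD C-pv24g6-1, D1/W1): the docstring of `axisConjInvariant_condLaw` now locates the printed
gauge invariance at [Balaban1987RG1] (1.19) p. 263 w.r.t. the action (1.10) p. 262 (v1's «(1.10) p. 20 of [B13]»
did not resolve); source declarations: 59 = 51 `theorem` + 2 `@[simp] theorem` + 6 `def` (61 gate records with the
two `eq_1`); NO statement, proof or other docstring changed.
-/

noncomputable section

open MeasureTheory Metric Set
open Function (updateFinset)
open scoped ENNReal

namespace Literature.MathematicalPhysics.QuantumFieldTheory.Balaban1983to89

open T4AdInvariant T4CoReadMoment T4CoReadAxial T4FlatExteriorInvariance T4DressingDefect GaugeField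

namespace T4CoReadAxialCondLaw

/-! ## §1 (G7-1)  Axis elements commute; axial exteriors are fixed by every axis conjugation -/

section AxisAlgebra

/-- The identity is on the axis. [folklore] -/
theorem one_isAxis : IsAxis (1 : Matrix.specialUnitaryGroup (Fin 2) ℂ) := by
  constructor <;> simp

/-- AXIS ELEMENTS COMMUTE: the axis `{diag(w, w̄)}` is an abelian subgroup (the maximal torus U(1) ⊂ SU(2)).
[folklore] -/
theorem commute_of_isAxis {h k : Matrix.specialUnitaryGroup (Fin 2) ℂ} (hh : IsAxis h) (hk : IsAxis k) :
    h * k = k * h := by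
  obtain ⟨h01, h10⟩ := hh
  obtain ⟨k01, k10⟩ := hk
  apply Subtype.ext
  change (h : Matrix (Fin 2) (Fin 2) ℂ) * (k : Matrix (Fin 2) (Fin 2) ℂ) =
    (k : Matrix (Fin 2) (Fin 2) ℂ) * (h : Matrix (Fin 2) (Fin 2) ℂ)
  ext i j
  fin_cases i <;> fin_cases j <;>
    simp [Matrix.mul_apply, Fin.sum_univ_two, h01, h10, k01, k10, mul_comm]

/-- Hence an axis element is FIXED under conjugation by any axis element. [folklore] -/
theorem conj_eq_of_isAxis {h k : Matrix.specialUnitaryGroup (Fin 2) ℂ} (hh : IsAxis h) (hk : IsAxis k) :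
    h * k * h⁻¹ = k := by
  rw [commute_of_isAxis hh hk, mul_inv_cancel_right]

/-- Conversely, an element fixed under conjugation by the π-rotation `diag(i, −i)` is on the axis (the centraliser
of the torus in SU(2) is the torus). [folklore] -/
theorem isAxis_of_phaseU_conj_eq {k : Matrix.specialUnitaryGroup (Fin 2) ℂ}
    (hk : (⟨phaseU, phaseU_mem⟩ : Matrix.specialUnitaryGroup (Fin 2) ℂ) * k * ⟨phaseU, phaseU_mem⟩⁻¹ = k) :
    IsAxis k := by
  have e : phaseU * (k : Matrix (Fin 2) (Fin 2) ℂ) * star phaseU = (k : Matrix (Fin 2) (Fin 2) ℂ) :=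
    congrArg Subtype.val hk
  have h01 := congrFun (congrFun e 0) 1
  have h10 := congrFun (congrFun e 1) 0
  rw [phaseU_conj_apply_01] at h01
  rw [phaseU_conj_apply_10] at h10
  constructor
  · have h2 : (2 : ℂ) * (k : Matrix (Fin 2) (Fin 2) ℂ) 0 1 = 0 := by linear_combination (-1 : ℂ) * h01
    exact (mul_eq_zero.mp h2).resolve_left two_ne_zero
  · have h2 : (2 : ℂ) * (k : Matrix (Fin 2) (Fin 2) ℂ) 1 0 = 0 := by linear_combination (-1 : ℂ) * h10
    exact (mul_eq_zero.mp h2).resolve_left two_ne_zero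

end AxisAlgebra

/-! ## §2 (G7-2)  Axial exteriors and the axis invariance of the model conditional law -/

section Exterior

variable {P : Params} {j : ℕ}

/-- HYPOTHESIS SHAPE (G7-α): the exterior gauge field is AXIAL off the fibre `s` — every bond variable outside `s`
lies on the axis `{diag(w, w̄)}` (a uni-directional background in axis-adapted colour coordinates; the FLAT exterior
`V⌈_{sᶜ} ≡ 1` of `T4FlatExteriorInvariance` is the case `w ≡ 1`). Nothing printed is asserted to have this shape.
[folklore] -/
def AxialExterior (s : Finset (PBond P j)) (V : GaugeField P j (Matrix.specialUnitaryGroup (Fin 2) ℂ)) : Prop :=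
  ∀ b ∉ s, IsAxis (V b)

/-- A flat exterior is axial. [folklore] -/
theorem axialExterior_of_flat {s : Finset (PBond P j)} {V : GaugeField P j (Matrix.specialUnitaryGroup (Fin 2) ℂ)}
    (hV : ∀ b ∉ s, V b = 1) : AxialExterior s V :=
  fun b hb => by rw [hV b hb]; exact one_isAxis

/-- AN AXIAL EXTERIOR IS FIXED OFF THE FIBRE BY EVERY AXIS CONJUGATION — the hypothesis `ConjFixedOff s h V` of
`T4FlatExteriorInvariance.condLaw_map_conjFun`, for every `h` on the axis. [folklore] -/
theorem AxialExterior.conjFixedOff {s : Finset (PBond P j)}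
    {V : GaugeField P j (Matrix.specialUnitaryGroup (Fin 2) ℂ)} (hV : AxialExterior s V)
    {h : Matrix.specialUnitaryGroup (Fin 2) ℂ} (hh : IsAxis h) : ConjFixedOff s h V :=
  fun b hb => conj_eq_of_isAxis hh (hV b hb)

/-- … and conversely: the exteriors fixed off `s` by every axis conjugation are EXACTLY the axial ones (so (G7-α) is
the natural exterior class of the residual symmetry, not a convenient sub-case). [folklore] -/
theorem axialExterior_iff_conjFixedOff (s : Finset (PBond P j))
    (V : GaugeField P j (Matrix.specialUnitaryGroup (Fin 2) ℂ)) :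
    AxialExterior s V ↔ ∀ h : Matrix.specialUnitaryGroup (Fin 2) ℂ, IsAxis h → ConjFixedOff s h V :=
  ⟨fun hV _ hh => hV.conjFixedOff hh, fun H b hb => isAxis_of_phaseU_conj_eq (H _ phaseU_isAxis b hb)⟩

variable [DecidableEq (PBond P j)]

/-- **(G7-2) THE RESIDUAL AXIS SYMMETRY (A1) OF `T4CoReadAxial` HOLDS, BY NAME, FOR THE MODEL CONDITIONAL LAW AT AN
AXIAL EXTERIOR.** For pv04's model `condLaw s old V` of the conditional law `E_t[· | V_out]` (`T4DressingDefect`: the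
density `old` against product Haar on the fibre over `s`, exterior `V`), a conjugation-invariant density (`ConjInvariant
old` — printed SOURCE of this hypothesis for Bałaban's effective-action terms: the gauge invariance (1.19) p. 263 of
[Balaban1987RG1] («for all G^c-valued gauge transformations u») with respect to the action (1.10) p. 262 there
(«(U, J)^u = (U^u, R(u)J) = (u₋Uu₊⁻¹, R(u₋)J)»), both read by this seat on the rendered journal pages, record
`t4/T4-EST-O3Eiiib-G7.md` (P2); specialised to constant `u ∈ G` it is pv04-g6's `conjInvariant_of_gaugeInvariant`
[v1.0.1: v1 wrote «(1.10) p. 20 of [B13]», a non-resolving locator — XREAD C-pv24g6-1 D1]) and an axial exterior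
give invariance of the conditional law under simultaneous
conjugation of the fibre variables by every AXIS element. Proof: `condLaw_map_conjFun` (pv04-g6) at the fixedness
(G7-1). At a flat exterior this is pv04-g6's full invariance restricted to the axis; off flat-but-axial it is NEW
kernel content (full invariance fails there, `T4CoReadAxial.orbitLaw_not_flat` being the two-point model). [folklore] -/
theorem axisConjInvariant_condLaw (s : Finset (PBond P j))
    {old : Density P j (Matrix.specialUnitaryGroup (Fin 2) ℂ)} (hold : ConjInvariant old)
    {V : GaugeField P j (Matrix.specialUnitaryGroup (Fin 2) ℂ)} (hV : AxialExterior s V) :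
    AxisConjInvariant (condLaw s old V) (conjAll (ι := ↥s)) :=
  fun h hh => ⟨(measurable_conjFun (ι := ↥s) h).aemeasurable, condLaw_map_conjFun s hold (hV.conjFixedOff hh)⟩

/-- In particular the single-element form (A1′): invariance under the π-rotation `diag(i, −i)`. [folklore] -/
theorem phaseConjInvariant_condLaw (s : Finset (PBond P j))
    {old : Density P j (Matrix.specialUnitaryGroup (Fin 2) ℂ)} (hold : ConjInvariant old)
    {V : GaugeField P j (Matrix.specialUnitaryGroup (Fin 2) ℂ)} (hV : AxialExterior s V) :
    PhaseConjInvariant (condLaw s old V) (conjAll (ι := ↥s)) :=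
  (axisConjInvariant_condLaw s hold hV).phase

/-- The same for the un-normalised fibre law. [folklore] -/
theorem fibreLaw_map_conjAll_of_isAxis (s : Finset (PBond P j))
    {old : Density P j (Matrix.specialUnitaryGroup (Fin 2) ℂ)} (hold : ConjInvariant old)
    {V : GaugeField P j (Matrix.specialUnitaryGroup (Fin 2) ℂ)} (hV : AxialExterior s V)
    {h : Matrix.specialUnitaryGroup (Fin 2) ℂ} (hh : IsAxis h) :
    (fibreLaw s old V).map (conjAll (ι := ↥s) h) = fibreLaw s old V :=
  fibreLaw_map_conjFun s hold (hV.conjFixedOff hh)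

end Exterior

/-! ## §3 (G7-3)  Equivariant inserts on the fibre and the consequences for the model conditional law -/

section Inserts

variable {ι : Type*}

/-- The COORDINATE INSERT at a fibre bond `b`: the bond variable itself, as a `2 × 2` complex array. [folklore] -/
def coordInsert (b : ι) (y : ι → Matrix.specialUnitaryGroup (Fin 2) ℂ) : Fin 2 → Fin 2 → ℂ :=
  fun i k => (y b : Matrix (Fin 2) (Fin 2) ℂ) i k

/-- `coordInsert b y i k = (y b) i k`. [folklore] -/
@[simp] theorem coordInsert_apply (b : ι) (y : ι → Matrix.specialUnitaryGroup (Fin 2) ℂ) (i k : Fin 2) :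
    coordInsert b y i k = (y b : Matrix (Fin 2) (Fin 2) ℂ) i k := rfl

/-- THE COORDINATE INSERTS ARE `conjAll`-EQUIVARIANT: `(h·y_b·h⁻¹) = h·y_b·h⋆` entrywise (`h⁻¹ = h⋆` in SU(2)) — so
the consequences below are not vacuous: the bond variables themselves, their products (`conjEquivariant_mprod`),
differences (`conjEquivariant_sub`), adjoints and linear combinations (next lemmas) are admissible inserts. [folklore] -/
theorem coordInsert_conjEquivariant (b : ι) : ConjEquivariant (conjAll (ι := ι)) (coordInsert b) := by
  intro h y
  funext i k
  rfl

variable {X : Type*} {T : Matrix.specialUnitaryGroup (Fin 2) ℂ → X → X}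

/-- The entrywise ADJOINT of an equivariant insert is equivariant (`h (v⋆) h⋆ = (h v h⋆)⋆`). [folklore] -/
theorem conjEquivariant_star {f : X → Fin 2 → Fin 2 → ℂ} (hf : ConjEquivariant T f) :
    ConjEquivariant T (fun x i k => star (f x k i)) := by
  intro h x
  funext i k
  simp only [hf h x, conjOp_apply, Matrix.mul_apply, Fin.sum_univ_two, Matrix.star_apply, Matrix.of_apply,
    star_add, star_mul', star_star]
  ring

/-- Sums of equivariant inserts are equivariant. [folklore] -/
theorem conjEquivariant_add {f g : X → Fin 2 → Fin 2 → ℂ} (hf : ConjEquivariant T f) (hg : ConjEquivariant T g) :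
    ConjEquivariant T (fun x => f x + g x) := by
  intro h x
  simp only [hf h x, hg h x, map_add]

/-- Complex scalar multiples of equivariant inserts are equivariant. [folklore] -/
theorem conjEquivariant_smul {f : X → Fin 2 → Fin 2 → ℂ} (hf : ConjEquivariant T f) (c : ℂ) :
    ConjEquivariant T (fun x => c • f x) := by
  intro h x
  show c • f (T h x) = conjOp (h : Matrix (Fin 2) (Fin 2) ℂ) (c • f x)
  rw [hf h x]
  funext i k
  simp only [Pi.smul_apply, conjOp_apply, smul_eq_mul, Matrix.mul_apply, Fin.sum_univ_two, Matrix.of_apply,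
    Matrix.star_apply]
  ring

/-- The ANTI-HERMITIAN PART `(v − v⋆)/2` of an equivariant insert — the `𝔲(2)`-projection of a bond variable, the
species of the fluctuation inserts `B_b` — is equivariant. [folklore] -/
theorem conjEquivariant_antiHerm {f : X → Fin 2 → Fin 2 → ℂ} (hf : ConjEquivariant T f) :
    ConjEquivariant T (fun x => (1 / 2 : ℂ) • (f x - fun i k => star (f x k i))) :=
  conjEquivariant_smul (conjEquivariant_sub hf (conjEquivariant_star hf)) _

end Inserts

section Consequences

variable {P : Params} {j : ℕ} [DecidableEq (PBond P j)]

/-- **(G7-3a) THE CONDITIONAL PAIR MEAN IS AXIAL.** At an axial exterior and a conjugation-invariant density, the mean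
under the model conditional law of the commutator of two equivariant fibre inserts is the axial matrix
`diag(a, −a)` — ONE complex scalar survives (vs. `0` at a flat exterior, `T4FlatExteriorInvariance.integral_condLaw_eq_zero`
+ `T4CoReadMoment`). [folklore] -/
theorem integral_mcomm_condLaw_eq_axial (s : Finset (PBond P j))
    {old : Density P j (Matrix.specialUnitaryGroup (Fin 2) ℂ)} (hold : ConjInvariant old)
    {V : GaugeField P j (Matrix.specialUnitaryGroup (Fin 2) ℂ)} (hV : AxialExterior s V)
    {f g : (↥s → Matrix.specialUnitaryGroup (Fin 2) ℂ) → Fin 2 → Fin 2 → ℂ}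
    (hf : ConjEquivariant (conjAll (ι := ↥s)) f) (hg : ConjEquivariant (conjAll (ι := ↥s)) g) :
    ∫ y, mcomm f g y ∂(condLaw s old V) = axial ((∫ y, mcomm f g y ∂(condLaw s old V)) 0 0) :=
  integral_mcomm_eq_axial (axisConjInvariant_condLaw s hold hV) hf hg

/-- **(G7-3b) THE CONDITIONAL PAIR MEAN FIELD OF A FAMILY OF EQUIVARIANT INSERTS IS AXIAL**, pair by pair. [folklore] -/
theorem pairMeanField_condLaw_eq_axial (s : Finset (PBond P j))
    {old : Density P j (Matrix.specialUnitaryGroup (Fin 2) ℂ)} (hold : ConjInvariant old)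
    {V : GaugeField P j (Matrix.specialUnitaryGroup (Fin 2) ℂ)} (hV : AxialExterior s V)
    {β : Type*} {B : (↥s → Matrix.specialUnitaryGroup (Fin 2) ℂ) → β → Fin 2 → Fin 2 → ℂ}
    (hB : ∀ b, ConjEquivariant (conjAll (ι := ↥s)) (fun y => B y b)) (p : β × β) :
    pairMeanField (condLaw s old V) B p = axial (pairMeanField (condLaw s old V) B p 0 0) :=
  pairMeanField_eq_axial (axisConjInvariant_condLaw s hold hV) hB p

/-- (G7-3b) for the coordinate inserts themselves (non-vacuity). [folklore] -/
theorem pairMeanField_condLaw_coord_eq_axial (s : Finset (PBond P j))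
    {old : Density P j (Matrix.specialUnitaryGroup (Fin 2) ℂ)} (hold : ConjInvariant old)
    {V : GaugeField P j (Matrix.specialUnitaryGroup (Fin 2) ℂ)} (hV : AxialExterior s V) (p : ↥s × ↥s) :
    pairMeanField (condLaw s old V) (fun y b => coordInsert b y) p =
      axial (pairMeanField (condLaw s old V) (fun y b => coordInsert b y) p 0 0) :=
  pairMeanField_condLaw_eq_axial s hold hV (fun b => coordInsert_conjEquivariant b) p

/-- **(G7-3c) TRANSVERSE CONTRACTIONS OF THE CONDITIONAL PAIR MEAN VANISH** at an axial exterior: for any continuous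
ℝ-linear functional killing the axial matrices (the `σ₁, σ₂` components of the `𝒟`-contraction). [folklore] -/
theorem integral_clm_mcomm_condLaw_eq_zero_of_transverse (s : Finset (PBond P j))
    {old : Density P j (Matrix.specialUnitaryGroup (Fin 2) ℂ)} (hold : ConjInvariant old)
    {V : GaugeField P j (Matrix.specialUnitaryGroup (Fin 2) ℂ)} (hV : AxialExterior s V)
    {f g : (↥s → Matrix.specialUnitaryGroup (Fin 2) ℂ) → Fin 2 → Fin 2 → ℂ}
    (hf : ConjEquivariant (conjAll (ι := ↥s)) f) (hg : ConjEquivariant (conjAll (ι := ↥s)) g)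
    {F : Type*} [NormedAddCommGroup F] [NormedSpace ℝ F] [CompleteSpace F] (ℓ : (Fin 2 → Fin 2 → ℂ) →L[ℝ] F)
    (hℓ : ∀ a : ℂ, ℓ (axial a) = 0) (hint : Integrable (mcomm f g) (condLaw s old V)) :
    ∫ y, ℓ (mcomm f g y) ∂(condLaw s old V) = 0 :=
  integral_clm_mcomm_eq_zero_of_transverse (axisConjInvariant_condLaw s hold hV) hf hg ℓ hℓ hint

/-- **(G7-3d) A SINGLE TRACELESS EQUIVARIANT INSERT HAS AXIAL CONDITIONAL MEAN** at an axial exterior (vs. mean `0` at a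
flat one, `T4FlatExteriorInvariance.meanVanishes_condLaw`). [folklore] -/
theorem integral_condLaw_eq_axial (s : Finset (PBond P j))
    {old : Density P j (Matrix.specialUnitaryGroup (Fin 2) ℂ)} (hold : ConjInvariant old)
    {V : GaugeField P j (Matrix.specialUnitaryGroup (Fin 2) ℂ)} (hV : AxialExterior s V)
    {f : (↥s → Matrix.specialUnitaryGroup (Fin 2) ℂ) → Fin 2 → Fin 2 → ℂ}
    (hf : ConjEquivariant (conjAll (ι := ↥s)) f) (htr : ∀ y, f y 0 0 + f y 1 1 = 0) :
    ∫ y, f y ∂(condLaw s old V) = axial ((∫ y, f y ∂(condLaw s old V)) 0 0) :=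
  integral_eq_axial (axisConjInvariant_condLaw s hold hV) hf htr

end Consequences

/-! ## §4 (G7-4)  The Lipschitz half of O-G7 from analyticity: Schwarz's lemma -/

section Schwarz

variable {𝒰 : Type*} [NormedAddCommGroup 𝒰] [NormedSpace ℂ 𝒰] {E : Type*} [NormedAddCommGroup E] [NormedSpace ℂ E]

/-- **(G7-4) LIPSCHITZ AT THE REFERENCE POINT FROM ANALYTICITY (Schwarz).** An `E`-valued function of an exterior
parameter `u ∈ 𝒰` (any complex normed space: one complex deformation parameter, or a complex Banach space of
complexified exterior fields), complex-differentiable on the open ball of radius `R` about the reference `u₀` with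
oscillation `‖a u − a u₀‖ ≤ M` there, satisfies `‖a u − a u₀‖ ≤ (M / R)·‖u − u₀‖` on that ball (Mathlib's
`Complex.dist_le_div_mul_dist_of_mapsTo_ball`). HYPOTHESIS SHAPES: nothing printed is asserted analytic or bounded.
[folklore] -/
theorem norm_sub_le_div_mul_of_differentiableOn {a : 𝒰 → E} {u₀ : 𝒰} {R M : ℝ}
    (hd : DifferentiableOn ℂ a (ball u₀ R)) (hM : ∀ u ∈ ball u₀ R, ‖a u - a u₀‖ ≤ M) {u : 𝒰}
    (hu : u ∈ ball u₀ R) : ‖a u - a u₀‖ ≤ M / R * ‖u - u₀‖ := by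
  have hmaps : MapsTo a (ball u₀ R) (closedBall (a u₀) M) :=
    fun v hv => mem_closedBall.mpr (by rw [dist_eq_norm]; exact hM v hv)
  have h := Complex.dist_le_div_mul_dist_of_mapsTo_ball hd hmaps hu
  rwa [dist_eq_norm, dist_eq_norm] at h

/-- (G7-4) with a SUP BOUND and a ZERO at the reference point (the flat point, where the pair mean vanishes — (K9)):
`‖a u‖ ≤ (M / R)·‖u − u₀‖`. [folklore] -/
theorem norm_le_div_mul_of_differentiableOn {a : 𝒰 → E} {u₀ : 𝒰} {R M : ℝ}
    (hd : DifferentiableOn ℂ a (ball u₀ R)) (h0 : a u₀ = 0) (hM : ∀ u ∈ ball u₀ R, ‖a u‖ ≤ M) {u : 𝒰}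
    (hu : u ∈ ball u₀ R) : ‖a u‖ ≤ M / R * ‖u - u₀‖ := by
  have h := norm_sub_le_div_mul_of_differentiableOn hd (fun v hv => by simpa [h0] using hM v hv) hu
  simpa [h0] using h

/-- **(G7-4′) THE HAND-OFF TO `T4CoReadMoment.pairMean_norm_le_of_lipschitz`**: its Lipschitz hypothesis `hL` is
DISCHARGED on `dom = ball u₀ R` with `lip = M / R` and `dev u = ‖u − u₀‖` for an exterior-indexed pair mean field
`u ↦ m₂ u p` each of whose finitely many relevant components is complex-differentiable on the ball with oscillation
`≤ M`. [folklore] -/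
theorem pairMean_lipschitz_of_differentiableOn {β : Type*} {m₂ : 𝒰 → β × β → E} {S : Finset (β × β)} {u₀ : 𝒰}
    {R M : ℝ} (hd : ∀ p ∈ S, DifferentiableOn ℂ (fun u => m₂ u p) (ball u₀ R))
    (hM : ∀ p ∈ S, ∀ u ∈ ball u₀ R, ‖m₂ u p - m₂ u₀ p‖ ≤ M) :
    ∀ u ∈ ball u₀ R, ∀ p ∈ S, ‖m₂ u p - m₂ u₀ p‖ ≤ M / R * ‖u - u₀‖ :=
  fun _ hu p hp => norm_sub_le_div_mul_of_differentiableOn (hd p hp) (hM p hp) hu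

/-- **(G7-4″) O-G7's quantitative half, reduced**: zero pair mean at the flat reference `u₀` (K9) + componentwise
analyticity in the exterior on a ball of radius `R` + a sup bound `M` there ⇒ `‖m₂ u p‖ ≤ (M / R)·‖u − u₀‖` — the
conclusion of `pairMean_norm_le_of_lipschitz` with the Lipschitz modulus no longer a hypothesis but `M / R`.
The two inputs `R` (analyticity radius in the background field) and `M` (uniform bound) are of the printed SPECIES
of the analyticity-domain estimates; they are HYPOTHESES here. [folklore] -/
theorem pairMean_norm_le_of_differentiableOn {β : Type*} {m₂ : 𝒰 → β × β → E} {S : Finset (β × β)} {u₀ : 𝒰}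
    {R M : ℝ} (h0 : ∀ p ∈ S, m₂ u₀ p = 0) (hd : ∀ p ∈ S, DifferentiableOn ℂ (fun u => m₂ u p) (ball u₀ R))
    (hM : ∀ p ∈ S, ∀ u ∈ ball u₀ R, ‖m₂ u p‖ ≤ M) :
    ∀ u ∈ ball u₀ R, ∀ p ∈ S, ‖m₂ u p‖ ≤ M / R * ‖u - u₀‖ :=
  pairMean_norm_le_of_lipschitz h0
    (pairMean_lipschitz_of_differentiableOn hd fun p hp u hu => by simpa [h0 p hp] using hM p hp u hu)

/-- SHARPNESS of the constant `M / R`: attained by a linear function of one complex parameter. [folklore] -/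
theorem schwarz_const_sharp {R M : ℝ} (hR : 0 < R) (hM : 0 ≤ M) (t : ℂ) :
    ‖(M / R : ℂ) * t‖ = M / R * ‖t - 0‖ := by
  rw [sub_zero, norm_mul]
  congr 1
  rw [show (M / R : ℂ) = ((M / R : ℝ) : ℂ) by push_cast; rfl, Complex.norm_real, Real.norm_eq_abs,
    abs_of_nonneg (div_nonneg hM hR.le)]

end Schwarz

/-! ## §5 (G7-5)  Covariance of the model conditional law in the exterior; Weyl-oddness of the surviving scalar -/

section Covariance

variable {P : Params} {j : ℕ} {G : Type*} [GaugeGroup G] [MeasurableSpace G] [HaarData G]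

omit [GaugeGroup G] [MeasurableSpace G] [HaarData G] in
/-- TRANSPORT LEMMA (two densities): a measurable automorphism `e` preserving `ν` carries `ν.withDensity (d ∘ e)` to
`ν.withDensity d` (the twin of pv04-g6's `map_withDensity_eq_of_invariant`, which is the case `d ∘ e = d`).
[folklore] -/
theorem map_withDensity_comp_eq {X : Type*} [MeasurableSpace X] (ν : Measure X) (e : X ≃ᵐ X) (hν : ν.map e = ν)
    (d : X → ℝ≥0∞) : (ν.withDensity (d ∘ e)).map e = ν.withDensity d := by
  ext A hA
  have hA' : MeasurableSet (e ⁻¹' A) := hA.preimage e.measurable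
  rw [e.map_apply, withDensity_apply _ hA', withDensity_apply _ hA]
  calc ∫⁻ x in e ⁻¹' A, (d ∘ e) x ∂ν = ∫⁻ y in A, d y ∂(ν.map e) := by
        rw [e.measurableEmbedding.restrict_map, lintegral_map_equiv]; rfl
    _ = ∫⁻ y in A, d y ∂ν := by rw [hν]

variable [DecidableEq (PBond P j)]

omit [MeasurableSpace G] [HaarData G] in
/-- JOINT INSERTION IDENTITY (no fixedness hypothesis; cf. pv06-g8's `T4NestedCovarianceFibre.updateFinset_jrot`):
inserting conjugated fibre variables into the conjugated exterior is conjugating the whole inserted configuration,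
`(g·V·g⁻¹)←(g·y·g⁻¹) = g·(V←y)·g⁻¹`. [folklore] -/
theorem updateFinset_conjFun_conjFun (s : Finset (PBond P j)) (g : G) (V : GaugeField P j G) (y : ↥s → G) :
    updateFinset (conjFun g V) s (conjFun g y) = conjFun g (updateFinset V s y) := by
  funext b
  by_cases hb : b ∈ s
  · simp only [updateFinset, conjFun_apply, dif_pos hb]
  · simp only [updateFinset, conjFun_apply, dif_neg hb]

omit [GaugeGroup G] [MeasurableSpace G] [HaarData G] in
/-- Two exteriors that agree off `s` give the same inserted configurations. [folklore] -/
theorem updateFinset_eq_of_eq_off {s : Finset (PBond P j)} {V V' : GaugeField P j G} (h : ∀ b ∉ s, V b = V' b)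
    (y : ↥s → G) : updateFinset V s y = updateFinset V' s y := by
  funext b
  by_cases hb : b ∈ s
  · simp only [updateFinset, dif_pos hb]
  · simp only [updateFinset, dif_neg hb, h b hb]

/-- The fibre law sees the exterior only off `s`. [folklore] -/
theorem fibreLaw_eq_of_eq_off (s : Finset (PBond P j)) (old : Density P j G) {V V' : GaugeField P j G}
    (h : ∀ b ∉ s, V b = V' b) : fibreLaw s old V = fibreLaw s old V' := by
  unfold fibreLaw
  congr 1
  funext y
  rw [updateFinset_eq_of_eq_off h]

/-- The conditional law sees the exterior only off `s`. [folklore] -/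
theorem condLaw_eq_of_eq_off (s : Finset (PBond P j)) (old : Density P j G) {V V' : GaugeField P j G}
    (h : ∀ b ∉ s, V b = V' b) : condLaw s old V = condLaw s old V' := by
  unfold condLaw
  rw [fibreLaw_eq_of_eq_off s old h]

/-- **COVARIANCE OF THE FIBRE LAW IN THE EXTERIOR** (no fixedness): for a conjugation-invariant density, pushing the
fibre law at exterior `V` forward along the simultaneous conjugation of the fibre variables gives the fibre law at
the CONJUGATED exterior `g·V·g⁻¹`.  pv04-g6's `fibreLaw_map_conjFun` is the case of a `g`-fixed exterior; the
measure-level twin of pv06-g8's form-level `T4NestedCovarianceFibre.covariant_fibreForm` (no `Measurable old` /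
`0 ≤ old` binder is needed at this level). [folklore] -/
theorem fibreLaw_map_conjFun_eq [MeasurableMul G] (s : Finset (PBond P j)) {old : Density P j G}
    (hold : ConjInvariant old) (g : G) (V : GaugeField P j G) :
    (fibreLaw s old V).map (conjFun g) = fibreLaw s old (conjFun g V) := by
  have key : (fun y : ↥s → G => ENNReal.ofReal (old (updateFinset V s y))) =
      (fun y : ↥s → G => ENNReal.ofReal (old (updateFinset (conjFun g V) s y))) ∘ (conjEquiv (↥s) g) := by
    funext y
    simp only [Function.comp_apply, coe_conjEquiv, updateFinset_conjFun_conjFun]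
    rw [hold g]
  unfold fibreLaw
  rw [key]
  simpa only [coe_conjEquiv] using
    map_withDensity_comp_eq (Measure.pi fun _ : ↥s => (HaarData.haar : Measure G)) (conjEquiv (↥s) g)
      (by simpa only [coe_conjEquiv] using pi_haar_map_conjFun (ι := ↥s) g) _

/-- The total mass of the fibre law is unchanged by conjugating the exterior. [folklore] -/
theorem fibreLaw_conjFun_univ [MeasurableMul G] (s : Finset (PBond P j)) {old : Density P j G}
    (hold : ConjInvariant old) (g : G) (V : GaugeField P j G) :
    fibreLaw s old (conjFun g V) Set.univ = fibreLaw s old V Set.univ := by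
  rw [← fibreLaw_map_conjFun_eq s hold g V, Measure.map_apply (measurable_conjFun g) MeasurableSet.univ,
    Set.preimage_univ]

/-- **COVARIANCE OF THE CONDITIONAL LAW `E_t[· | V_out]` IN THE EXTERIOR**: `(conj_g)_* E[· | V] = E[· | g·V·g⁻¹]`.
[folklore] -/
theorem condLaw_map_conjFun_eq [MeasurableMul G] (s : Finset (PBond P j)) {old : Density P j G}
    (hold : ConjInvariant old) (g : G) (V : GaugeField P j G) :
    (condLaw s old V).map (conjFun g) = condLaw s old (conjFun g V) := by
  unfold condLaw
  rw [Measure.map_smul, fibreLaw_map_conjFun_eq s hold g V, fibreLaw_conjFun_univ s hold g V]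

/-- Change of variables: `E[f ∘ conj_g | V] = E[f | g·V·g⁻¹]` for every integrand (no integrability needed).
[folklore] -/
theorem integral_condLaw_conjFun_eq [MeasurableMul G] (s : Finset (PBond P j)) {old : Density P j G}
    (hold : ConjInvariant old) (g : G) (V : GaugeField P j G) {E : Type*} [NormedAddCommGroup E] [NormedSpace ℝ E]
    (f : (↥s → G) → E) : ∫ y, f (conjFun g y) ∂(condLaw s old V) = ∫ y, f y ∂(condLaw s old (conjFun g V)) := by
  have h := MeasureTheory.integral_map_equiv (conjEquiv (↥s) g) (μ := condLaw s old V) f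
  rw [coe_conjEquiv, condLaw_map_conjFun_eq s hold g V] at h
  exact h.symm

end Covariance

section SU2Covariance

/-- `h⋆ (h v h⋆) h = v` for `h⋆ h = 1`. [folklore] -/
theorem conjOp_star_conjOp (H : Matrix (Fin 2) (Fin 2) ℂ) (hH : star H * H = 1) (v : Fin 2 → Fin 2 → ℂ) :
    conjOp (star H) (conjOp H v) = v := by
  change (fun i j => (star H * (H * Matrix.of v * star H) * star (star H)) i j) = v
  rw [star_star, ← Matrix.mul_assoc, ← Matrix.mul_assoc, hH, Matrix.one_mul, Matrix.mul_assoc, hH,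
    Matrix.mul_one]
  rfl

/-- `h (h⋆ v h) h⋆ = v` for `h h⋆ = 1`. [folklore] -/
theorem conjOp_conjOp_star (H : Matrix (Fin 2) (Fin 2) ℂ) (hH : H * star H = 1) (v : Fin 2 → Fin 2 → ℂ) :
    conjOp H (conjOp (star H) v) = v := by
  have h := conjOp_star_conjOp (star H) (by rwa [star_star]) v
  rwa [star_star] at h

/-- Conjugation by an element of SU(2) as a continuous ℝ-linear AUTOMORPHISM of the `2 × 2` arrays. [folklore] -/
def conjOpEquiv (h : Matrix.specialUnitaryGroup (Fin 2) ℂ) : (Fin 2 → Fin 2 → ℂ) ≃L[ℝ] (Fin 2 → Fin 2 → ℂ) :=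
  ContinuousLinearEquiv.equivOfInverse (conjOp (h : Matrix (Fin 2) (Fin 2) ℂ))
    (conjOp (star (h : Matrix (Fin 2) (Fin 2) ℂ))) (fun v => conjOp_star_conjOp _ h.prop.1.1 v)
    (fun v => conjOp_conjOp_star _ h.prop.1.2 v)

/-- `conjOpEquiv h v = conjOp h v`. [folklore] -/
@[simp] theorem conjOpEquiv_apply (h : Matrix.specialUnitaryGroup (Fin 2) ℂ) (v : Fin 2 → Fin 2 → ℂ) :
    conjOpEquiv h v = conjOp (h : Matrix (Fin 2) (Fin 2) ℂ) v := rfl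

/-- Conjugation commutes with the Bochner integral, with NO integrability hypothesis (it is an automorphism).
[folklore] -/
theorem integral_conjOp_comm {X : Type*} [MeasurableSpace X] (μ : Measure X)
    (h : Matrix.specialUnitaryGroup (Fin 2) ℂ) (φ : X → Fin 2 → Fin 2 → ℂ) :
    ∫ x, conjOp (h : Matrix (Fin 2) (Fin 2) ℂ) (φ x) ∂μ = conjOp (h : Matrix (Fin 2) (Fin 2) ℂ) (∫ x, φ x ∂μ) := by
  simpa only [conjOpEquiv_apply] using (conjOpEquiv h).integral_comp_comm (μ := μ) φ

variable {P : Params} {j : ℕ} [DecidableEq (PBond P j)]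

/-- **(G7-5) THE CONDITIONAL MEAN OF AN EQUIVARIANT INSERT IS Ad-EQUIVARIANT IN THE EXTERIOR**:
`E[F | h·V·h⁻¹] = h · E[F | V] · h⋆` for every `conjAll`-equivariant fibre insert `F`, every `h ∈ SU(2)` and EVERY
exterior `V` (no fixedness, no axiality, no integrability).  This is the exact structural content of «F(ψ) vanishes at
ψ = 0 by symmetry and is O(|ψ|) off it»: the mean is an EQUIVARIANT function of the exterior, zero on the fixed locus
(pv04-g6), axial on the axial locus (G7-3), and covariant everywhere. [folklore] -/
theorem integral_condLaw_conj_exterior (s : Finset (PBond P j))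
    {old : Density P j (Matrix.specialUnitaryGroup (Fin 2) ℂ)} (hold : ConjInvariant old)
    (h : Matrix.specialUnitaryGroup (Fin 2) ℂ) (V : GaugeField P j (Matrix.specialUnitaryGroup (Fin 2) ℂ))
    {F : (↥s → Matrix.specialUnitaryGroup (Fin 2) ℂ) → Fin 2 → Fin 2 → ℂ}
    (hF : ConjEquivariant (conjAll (ι := ↥s)) F) :
    ∫ y, F y ∂(condLaw s old (conjFun h V)) =
      conjOp (h : Matrix (Fin 2) (Fin 2) ℂ) (∫ y, F y ∂(condLaw s old V)) := by
  rw [← integral_condLaw_conjFun_eq s hold h V F, ← integral_conjOp_comm]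
  congr 1
  funext y
  exact hF h y

/-- THE WEYL ELEMENT `w₀ = [[0,1],[−1,0]] ∈ SU(2)` (the rotation by π about the 2-axis): it normalises the axis and
acts on it by inversion / complex conjugation, and it reverses the sign of `σ₃`. [folklore] -/
def weylU : Matrix.specialUnitaryGroup (Fin 2) ℂ := ⟨swapU, swapU_mem⟩

/-- `w₀ · diag(w, w̄) · w₀⁻¹ = diag(w̄, w)`: the Weyl element acts on the axis by inversion. [folklore] -/
theorem weylU_conj_axisU (w : Circle) : weylU * axisU w * weylU⁻¹ = axisU w⁻¹ := by
  apply Subtype.ext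
  change swapU * axisMat (w : ℂ) * star swapU = axisMat ((w⁻¹ : Circle) : ℂ)
  rw [Circle.coe_inv_eq_conj]
  ext i k
  fin_cases i <;> fin_cases k <;>
    simp [swapU, axisMat, Matrix.mul_apply, Fin.sum_univ_two, Matrix.star_apply]

/-- The Weyl conjugate of an axis element is on the axis. [folklore] -/
theorem isAxis_weylU_conj {k : Matrix.specialUnitaryGroup (Fin 2) ℂ} (hk : IsAxis k) :
    IsAxis (weylU * k * weylU⁻¹) := by
  obtain ⟨w, rfl⟩ := hk.exists_eq_axisU
  rw [weylU_conj_axisU]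
  exact axisU_isAxis _

omit [DecidableEq (PBond P j)] in
/-- The Weyl-reflected exterior of an axial exterior is axial. [folklore] -/
theorem AxialExterior.conjFun_weylU {s : Finset (PBond P j)}
    {V : GaugeField P j (Matrix.specialUnitaryGroup (Fin 2) ℂ)} (hV : AxialExterior s V) :
    AxialExterior s (conjFun weylU V) :=
  fun b hb => isAxis_weylU_conj (hV b hb)

/-- **(G7-6) WEYL-ODDNESS OF THE SURVIVING SCALAR.** For a traceless-valued equivariant fibre insert `F` (e.g. a
commutator `[f, g]` of equivariant inserts), the `(0,0)` entry of its conditional mean changes SIGN when the exterior is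
replaced by its Weyl reflection `w₀·V·w₀⁻¹` — for EVERY exterior `V`: `a(w₀Vw₀⁻¹) = −a(V)` (since
`(w₀ X w₀⋆)₀₀ = X₁₁ = −X₀₀` for traceless `X`). [folklore] -/
theorem integral_condLaw_weylU_apply_00 (s : Finset (PBond P j))
    {old : Density P j (Matrix.specialUnitaryGroup (Fin 2) ℂ)} (hold : ConjInvariant old)
    (V : GaugeField P j (Matrix.specialUnitaryGroup (Fin 2) ℂ))
    {F : (↥s → Matrix.specialUnitaryGroup (Fin 2) ℂ) → Fin 2 → Fin 2 → ℂ}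
    (hF : ConjEquivariant (conjAll (ι := ↥s)) F) (htr : ∀ y, F y 0 0 + F y 1 1 = 0) :
    (∫ y, F y ∂(condLaw s old (conjFun weylU V))) 0 0 = -(∫ y, F y ∂(condLaw s old V)) 0 0 := by
  rw [integral_condLaw_conj_exterior s hold weylU V hF]
  have htr' := trace_integral_eq_zero (μ := condLaw s old V) htr
  rw [show ((weylU : Matrix.specialUnitaryGroup (Fin 2) ℂ) : Matrix (Fin 2) (Fin 2) ℂ) = swapU from rfl,
    conjOp_apply, swapU_conj_apply_00, Matrix.of_apply]
  linear_combination htr'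

/-- (G7-6) for the conditional PAIR mean `a(V)(f, g) := (E[[f, g] | V])₀₀`: `a(w₀Vw₀⁻¹) = −a(V)`. [folklore] -/
theorem pairMean_condLaw_weylU_odd (s : Finset (PBond P j))
    {old : Density P j (Matrix.specialUnitaryGroup (Fin 2) ℂ)} (hold : ConjInvariant old)
    (V : GaugeField P j (Matrix.specialUnitaryGroup (Fin 2) ℂ))
    {f g : (↥s → Matrix.specialUnitaryGroup (Fin 2) ℂ) → Fin 2 → Fin 2 → ℂ}
    (hf : ConjEquivariant (conjAll (ι := ↥s)) f) (hg : ConjEquivariant (conjAll (ι := ↥s)) g) :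
    (∫ y, mcomm f g y ∂(condLaw s old (conjFun weylU V))) 0 0 = -(∫ y, mcomm f g y ∂(condLaw s old V)) 0 0 :=
  integral_condLaw_weylU_apply_00 s hold V (conjEquivariant_mcomm hf hg) (trace_mcomm f g)

/-- AN AXIS-VALUED GAUGE FIELD `b ↦ diag(w_b, w̄_b)` (a uni-directional configuration in axis-adapted coordinates).
[folklore] -/
def axisField (w : PBond P j → Circle) : GaugeField P j (Matrix.specialUnitaryGroup (Fin 2) ℂ) :=
  fun b => axisU (w b)

omit [DecidableEq (PBond P j)] in
/-- An axis-valued field is an axial exterior for every fibre. [folklore] -/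
theorem axialExterior_axisField (s : Finset (PBond P j)) (w : PBond P j → Circle) :
    AxialExterior s (axisField w) :=
  fun b _ => axisU_isAxis (w b)

omit [DecidableEq (PBond P j)] in
/-- THE WEYL REFLECTION OF AN AXIS-VALUED FIELD IS ITS INVERSE / COMPLEX CONJUGATE `b ↦ diag(w̄_b, w_b)`.
[folklore] -/
theorem conjFun_weylU_axisField (w : PBond P j → Circle) : conjFun weylU (axisField w) = axisField w⁻¹ := by
  funext b
  simp only [conjFun_apply, axisField, Pi.inv_apply, weylU_conj_axisU]

/-- **(G7-6′) ODDNESS UNDER COMPLEX CONJUGATION OF THE BACKGROUND**: at an axis-valued exterior the surviving scalar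
is odd under `w ↦ w̄`: `a(w̄) = −a(w)`. [folklore] -/
theorem pairMean_condLaw_axisField_odd (s : Finset (PBond P j))
    {old : Density P j (Matrix.specialUnitaryGroup (Fin 2) ℂ)} (hold : ConjInvariant old) (w : PBond P j → Circle)
    {f g : (↥s → Matrix.specialUnitaryGroup (Fin 2) ℂ) → Fin 2 → Fin 2 → ℂ}
    (hf : ConjEquivariant (conjAll (ι := ↥s)) f) (hg : ConjEquivariant (conjAll (ι := ↥s)) g) :
    (∫ y, mcomm f g y ∂(condLaw s old (axisField w⁻¹))) 0 0 =
      -(∫ y, mcomm f g y ∂(condLaw s old (axisField w))) 0 0 := by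
  rw [← conjFun_weylU_axisField]
  exact pairMean_condLaw_weylU_odd s hold (axisField w) hf hg

/-- A ONE-PARAMETER AXIAL DEFORMATION of the flat exterior: `t ↦ (b ↦ diag(e^{itθ_b}, e^{−itθ_b}))`, `t ∈ ℝ`
(`t = 0` is the flat exterior). [folklore] -/
def axisPath (θ : PBond P j → ℝ) (t : ℝ) : GaugeField P j (Matrix.specialUnitaryGroup (Fin 2) ℂ) :=
  axisField fun b => Circle.exp (t * θ b)

/-- `diag(1, 1) = 1`. [folklore] -/
theorem axisU_one : axisU 1 = 1 := by
  apply Subtype.ext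
  change axisMat ((1 : Circle) : ℂ) = 1
  ext i k
  fin_cases i <;> fin_cases k <;> simp [axisMat]

omit [DecidableEq (PBond P j)] in
/-- `axisPath θ 0` is the flat exterior. [folklore] -/
theorem axisPath_zero (θ : PBond P j → ℝ) : axisPath θ 0 = 1 := by
  funext b
  change axisU (Circle.exp (0 * θ b)) = 1
  rw [zero_mul, Circle.exp_zero, axisU_one]

omit [DecidableEq (PBond P j)] in
/-- Reversing the parameter is the Weyl reflection: `axisPath θ (−t) = w₀ · axisPath θ t · w₀⁻¹`. [folklore] -/
theorem axisPath_neg (θ : PBond P j → ℝ) (t : ℝ) : axisPath θ (-t) = conjFun weylU (axisPath θ t) := by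
  rw [axisPath, axisPath, conjFun_weylU_axisField]
  congr 1
  funext b
  simp only [Pi.inv_apply, neg_mul, Circle.exp_neg]

/-- **(G7-6″) THE SURVIVING SCALAR IS AN ODD FUNCTION OF THE DEFORMATION PARAMETER** along every one-parameter axial
deformation of the flat exterior: `a(−t) = −a(t)` — so it vanishes at `t = 0` (K9 again) TOGETHER WITH ALL ITS EVEN
TAYLOR COEFFICIENTS; with (G7-4) the first-order coefficient is bounded by `M / R`. [folklore] -/
theorem pairMean_condLaw_axisPath_odd (s : Finset (PBond P j))
    {old : Density P j (Matrix.specialUnitaryGroup (Fin 2) ℂ)} (hold : ConjInvariant old) (θ : PBond P j → ℝ)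
    (t : ℝ) {f g : (↥s → Matrix.specialUnitaryGroup (Fin 2) ℂ) → Fin 2 → Fin 2 → ℂ}
    (hf : ConjEquivariant (conjAll (ι := ↥s)) f) (hg : ConjEquivariant (conjAll (ι := ↥s)) g) :
    (∫ y, mcomm f g y ∂(condLaw s old (axisPath θ (-t)))) 0 0 =
      -(∫ y, mcomm f g y ∂(condLaw s old (axisPath θ t))) 0 0 := by
  rw [axisPath_neg]
  exact pairMean_condLaw_weylU_odd s hold (axisPath θ t) hf hg

/-- In particular at `t = 0` (the flat exterior) the scalar vanishes — (K9) recovered from oddness alone. [folklore] -/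
theorem pairMean_condLaw_axisPath_zero (s : Finset (PBond P j))
    {old : Density P j (Matrix.specialUnitaryGroup (Fin 2) ℂ)} (hold : ConjInvariant old) (θ : PBond P j → ℝ)
    {f g : (↥s → Matrix.specialUnitaryGroup (Fin 2) ℂ) → Fin 2 → Fin 2 → ℂ}
    (hf : ConjEquivariant (conjAll (ι := ↥s)) f) (hg : ConjEquivariant (conjAll (ι := ↥s)) g) :
    (∫ y, mcomm f g y ∂(condLaw s old (axisPath θ 0))) 0 0 = 0 := by
  have h := pairMean_condLaw_axisPath_odd s hold θ 0 hf hg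
  rw [neg_zero] at h
  linear_combination h / 2

end SU2Covariance

end T4CoReadAxialCondLaw

end Literature.MathematicalPhysics.QuantumFieldTheory.Balaban1983to89

end
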